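import Literature.MathematicalPhysics.QuantumFieldTheory.Balaban1983to89.B9Thm31CubeLocalFlat
import Literature.MathematicalPhysics.QuantumFieldTheory.Balaban1983to89.B9Ineq349MultiLevelTorusL0

/-!
# `Balaban1983to89.B9Ineq349CubeLocalFlat` — [B9] THEOREM 3.2, INEQUALITY (3.49), AT `U = 1` FOR THE CUBE-LOCAL LETTERS OF SECT. C
# (p. 409): the four kernel bounds of `P_□ = G′_□Q′*C_□Q′G′_□ = I − R_□` with THE inverse `C_□(1) = (Q′G′_□²Q′*)⁻¹` inside —
# HYPOTHESIS-FREE, at the def-Y-compatible weights `wCube`, BY NAME from the `…L0` lineage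
# (`B9Ineq349MultiLevelTorusL0.ineq349_multiLevelTorus` ∘ file 2 v1.1's `thm31_cubeW_flat_first ∕ second` ∘ `thm32_cubeW_flat`)
# (sub-row G-B9-LETTERS, module M5.1a, file 2c)

FRAMING (verbatim cell line):
statement-level skeleton of published theorems with citation tags; proofs where landed; nothing here is a claim about the Yang–Mills mass gap

Sources under audit (cell lit-balaban): T. Bałaban, *Propagators for lattice gauge theories in a background field*, Commun. Math. Phys. **99**
(1985) 389–434 [`Balaban1985BackgroundPropagators`, "B9"], Thm 3.2 (3.48)–(3.49) pp. 398–399, (3.25) p. 394, Cor. 3.5 p. 407, p. 409 l. 1–5;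
T. Bałaban, *Propagators and renormalization transformations for lattice gauge theories. II*, Commun. Math. Phys. **96** (1984) 223–250
[`Balaban1984PropagatorsII`, "[4]"], Prop. 2.2 (2.67) p. 234, Prop. 2.3 (2.87) p. 238, Lemma 2.1 p. 234.  Unit `lit-balaban-r05` (r05 gen 77).

## WHAT IS PRINTED (verbatim up to notation)

[B9] Thm 3.2 pp. 398–399 (the theorem opens with (3.48) on p. 398; its display (3.49) is on p. 399), (3.49): «|P(x, x′)|, |(D_UP)(x, x′)|, |(PD*_U)(x, x′)|, |(D_UPD*_U)(x, x′)| ≦ B₀[(L^{j′}η)^{−d}, (Lʲη)⁻¹(L^{j′}η)^{−d},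
(Lʲη)⁻¹(L^{j′}η)^{−d}, (Lʲη)⁻²(L^{j′}η)^{−d}]e^{−δ₀d(y,y′)} for x ∈ B^j(y), x′ ∈ B^{j′}(y′), where P = I − R = G′Q′*(Q′G′²Q′*)⁻¹Q′G′»;
p. 407 (Cor. 3.5): at `U = 1` proved in [4]; p. 409 l. 1–5: the cube letters «satisfy all the inequalities of Theorems 3.1–3.3».

## WHAT THIS FILE CERTIFIES (kernel-checked; lattice units; setting of `B9CubeSequence408`, weights `wCube` of file 2 v1.1 §4)

**`ineq349_cubeW_flat`**: there are `ρ, B, M₀ > 0`, `N₀ ≥ 1` (functions of `d, L` only) such that for every member `D` (odd `L ≥ 2`, odd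
`M_h ≥ 3` with `L·M_h ≥ M₀`, `R ≥ 2L` with `R·L·M_h ≥ N₀ + 1`, `P ≥ 4`), every cover cube `q`, with `F := cubeFam D q …`, `G′_□ = gmlT(F, wCube)`,
`C_□ := CinvCubeW D q …`: `C_□` is the two-sided inverse of the (2.87) operator of `F`; `P_□ := pProjMLT F wCube C_□ = G′_□Q′*C_□Q′G′_□` is
idempotent with `P_□R_□ = 0`; and for all torus points `x, x′` and axes `μ, ν` the four printed bounds
`|P_□(x,x′)| ≤ B·W(y(x′))⁻¹·e^{−ρ d(y(x),y(x′))}`, `|(∂_μP_□)(x,x′)|, |(P_□∂_νᵀ)(x,x′)| ≤ B·(L^{lev_□ x})⁻¹·W(y(x′))⁻¹·e^{−ρd}`,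
`|(∂_μP_□∂_νᵀ)(x,x′)| ≤ B·(L^{lev_□ x})⁻²·W(y(x′))⁻¹·e^{−ρd}` (`W(y′) = (L^{lev_□ x′})^{d+1}`; blocks, levels, distance of the CUBE family).
Mechanism: `ineq349_multiLevelTorus` (the Prop.-2.2 majorants and the inverse entering as arguments) fed with file 2 v1.1's
`thm31_cubeW_flat_first ∕ second` (constants merged by `max ∕ min`, `hasMajorant_mono`) and `thm32_cubeW_flat`.

v1.1 (same gen; DOCSTRINGS ONLY, code byte-identical to v1 p596210): r06 LANDING SWEEP №5 — «Thm 3.2 pp. 398–399, (3.49) p. 399».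

## HONEST SCOPE

* `U = 1`; cube family of file 1 (single scale, mass-`a = 1` floor = print's `a₀ = a`, (3.24) p. 394; its HONEST SCOPE applies verbatim).
* Nothing is inferred from the manuscript: one instantiation, kernel-checked.  NOT summit progress; the YM mass gap is not proved by any of this.
-/

namespace Literature.MathematicalPhysics.QuantumFieldTheory.Balaban1983to89.B9Ineq349CubeLocalFlat

open Literature.MathematicalPhysics.QuantumFieldTheory.Balaban1983to89.B4Reflection242 (boxDom)
open Literature.MathematicalPhysics.QuantumFieldTheory.Balaban1983to89.B6MultiLevelBoxOperator (N0)
open Literature.MathematicalPhysics.QuantumFieldTheory.Balaban1983to89.B6Cover236MultiLevelBlocks (cubes)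
open Literature.MathematicalPhysics.QuantumFieldTheory.Balaban1983to89.B6Geom246MultiLevelBoxL0 (bset blkOf)
open Literature.MathematicalPhysics.QuantumFieldTheory.Balaban1983to89.B6Geom246MultiLevelTorusL0 (geomT triangle_refl_nonneg_T)
open Literature.MathematicalPhysics.QuantumFieldTheory.Balaban1983to89.B6Ineq268MultiLevelBoxL0 (W)
open Literature.MathematicalPhysics.QuantumFieldTheory.Balaban1983to89.B6Expansion282 (kerOp)
open Literature.MathematicalPhysics.QuantumFieldTheory.Balaban1983to89.B6RandomWalk (HasMajorant hasMajorant_mono)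
open Literature.MathematicalPhysics.QuantumFieldTheory.Balaban1983to89.B6Prop22DerivMultiLevelTorus (dT)
open Literature.MathematicalPhysics.QuantumFieldTheory.Balaban1983to89.B8Ineq192MultiLevelTorusL0 (XkT rProjMLT)
open Literature.MathematicalPhysics.QuantumFieldTheory.Balaban1983to89.B9Ineq349MultiLevelTorusL0 (pProjMLT pProjMLT_idem pProjMLT_rProjMLT
  ineq349_multiLevelTorus)
open Literature.MathematicalPhysics.QuantumFieldTheory.Balaban1983to89.B9CubeSequence408 (cubeFam)
open Literature.MathematicalPhysics.QuantumFieldTheory.Balaban1983to89.B9Thm31CubeLocalFlat (wCube CinvCubeW thm31_cubeW_flat_first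
  thm31_cubeW_flat_second thm32_cubeW_flat)
open scoped Matrix

variable {d : ℕ}

/-- **(3.49) AT `U = 1` FOR THE CUBE-LOCAL LETTERS, HYPOTHESIS-FREE** (weights `wCube`): the inverse laws of `C_□(1)`, `P_□² = P_□`, `P_□R_□ = 0`,
and the four kernel bounds of `P_□ = G′_□Q′*C_□Q′G′_□`, `∂_μP_□`, `P_□∂_νᵀ`, `∂_μP_□∂_νᵀ` over the cube family's blocks.
[cite: Balaban1985BackgroundPropagators, Thm 3.2 (3.49) p.399, (3.25) p.394, with Cor. 3.5 p.407 and p.409 l.1–5; Balaban1984PropagatorsII, Prop. 2.2 (2.67) p.234, Prop. 2.3 (2.87) p.238] -/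
theorem ineq349_cubeW_flat (d ℓ : ℕ) (hℓ : 1 ≤ ℓ) :
    ∃ ρ B M₀ : ℝ, ∃ N₀ : ℕ, 0 < ρ ∧ 0 < B ∧ 0 < M₀ ∧ 0 < N₀ ∧
      ∀ {Mh k R : ℕ} {P : Fin (d + 1) → ℕ} (D : B6MultiLevelTorusOperator.TDomains d ℓ Mh k P R)
        (q : ↥(cubes D.toDomains)) (hL : Odd (ℓ + 1)) (hM : Odd Mh) (hMh : 1 ≤ Mh) (hP : ∀ μ, 1 ≤ P μ),
        3 ≤ Mh → M₀ ≤ ((ℓ : ℝ) + 1) * Mh → 2 * (ℓ + 1) ≤ R → N₀ + 1 ≤ R * ((ℓ + 1) * Mh) → (∀ μ, 4 ≤ P μ) →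
        CinvCubeW D q hL hM hMh hP *
            kerOp (W (cubeFam D q hL hM hMh hP).toDomains) (XkT (cubeFam D q hL hM hMh hP) (wCube ℓ)) = 1 ∧
        kerOp (W (cubeFam D q hL hM hMh hP).toDomains) (XkT (cubeFam D q hL hM hMh hP) (wCube ℓ)) *
            CinvCubeW D q hL hM hMh hP = 1 ∧
        (∀ f, pProjMLT (cubeFam D q hL hM hMh hP) (wCube ℓ) (CinvCubeW D q hL hM hMh hP)
            (pProjMLT (cubeFam D q hL hM hMh hP) (wCube ℓ) (CinvCubeW D q hL hM hMh hP) f) =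
          pProjMLT (cubeFam D q hL hM hMh hP) (wCube ℓ) (CinvCubeW D q hL hM hMh hP) f) ∧
        (∀ f, pProjMLT (cubeFam D q hL hM hMh hP) (wCube ℓ) (CinvCubeW D q hL hM hMh hP)
            (rProjMLT (cubeFam D q hL hM hMh hP) (wCube ℓ) (CinvCubeW D q hL hM hMh hP) f) = 0) ∧
        ∀ (x x' : ↥(boxDom (N0 ℓ Mh k P))),
          |pProjMLT (cubeFam D q hL hM hMh hP) (wCube ℓ) (CinvCubeW D q hL hM hMh hP) (Pi.single x' 1) x| ≤
            B * (W (cubeFam D q hL hM hMh hP).toDomains (blkOf (cubeFam D q hL hM hMh hP).toDomains x'))⁻¹ *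
              Real.exp (-(ρ * (geomT (cubeFam D q hL hM hMh hP)).dist
                (blkOf (cubeFam D q hL hM hMh hP).toDomains x) (blkOf (cubeFam D q hL hM hMh hP).toDomains x'))) ∧
          (∀ μ : Fin (d + 1),
            |(dT (N0 ℓ Mh k P) μ *ᵥ
                pProjMLT (cubeFam D q hL hM hMh hP) (wCube ℓ) (CinvCubeW D q hL hM hMh hP) (Pi.single x' 1)) x| ≤
            B * (((ℓ : ℝ) + 1) ^ (cubeFam D q hL hM hMh hP).lev x.1)⁻¹ *
              (W (cubeFam D q hL hM hMh hP).toDomains (blkOf (cubeFam D q hL hM hMh hP).toDomains x'))⁻¹ *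
              Real.exp (-(ρ * (geomT (cubeFam D q hL hM hMh hP)).dist
                (blkOf (cubeFam D q hL hM hMh hP).toDomains x) (blkOf (cubeFam D q hL hM hMh hP).toDomains x')))) ∧
          (∀ ν : Fin (d + 1),
            |pProjMLT (cubeFam D q hL hM hMh hP) (wCube ℓ) (CinvCubeW D q hL hM hMh hP)
                ((dT (N0 ℓ Mh k P) ν)ᵀ *ᵥ Pi.single x' 1) x| ≤
            B * (((ℓ : ℝ) + 1) ^ (cubeFam D q hL hM hMh hP).lev x.1)⁻¹ *
              (W (cubeFam D q hL hM hMh hP).toDomains (blkOf (cubeFam D q hL hM hMh hP).toDomains x'))⁻¹ *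
              Real.exp (-(ρ * (geomT (cubeFam D q hL hM hMh hP)).dist
                (blkOf (cubeFam D q hL hM hMh hP).toDomains x) (blkOf (cubeFam D q hL hM hMh hP).toDomains x')))) ∧
          (∀ μ ν : Fin (d + 1),
            |(dT (N0 ℓ Mh k P) μ *ᵥ pProjMLT (cubeFam D q hL hM hMh hP) (wCube ℓ) (CinvCubeW D q hL hM hMh hP)
                ((dT (N0 ℓ Mh k P) ν)ᵀ *ᵥ Pi.single x' 1)) x| ≤
            B * ((((ℓ : ℝ) + 1) ^ (cubeFam D q hL hM hMh hP).lev x.1) ^ 2)⁻¹ *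
              (W (cubeFam D q hL hM hMh hP).toDomains (blkOf (cubeFam D q hL hM hMh hP).toDomains x'))⁻¹ *
              Real.exp (-(ρ * (geomT (cubeFam D q hL hM hMh hP)).dist
                (blkOf (cubeFam D q hL hM hMh hP).toDomains x) (blkOf (cubeFam D q hL hM hMh hP).toDomains x')))) := by
  obtain ⟨δ₁, C₁, M₁, hδ₁, hC₁, hM₁, hP23⟩ := thm32_cubeW_flat d ℓ hℓ
  obtain ⟨δa, Ca, Ma, Na, hδa, hCa, hMa, hNa, hA⟩ := thm31_cubeW_flat_first d ℓ hℓ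
  obtain ⟨δb, Cb, Mb, Nb, hδb, hCb, hMb, hNb, hB⟩ := thm31_cubeW_flat_second d ℓ hℓ
  have hC : 0 < max Ca Cb := lt_max_of_lt_left hCa
  have hδ : 0 < min δa δb := lt_min hδa hδb
  obtain ⟨ρ, B, N₁, hρ, hB0, hN₁, hmain⟩ := ineq349_multiLevelTorus d ℓ hC hδ hC₁ hδ₁
  refine ⟨ρ, B, max (max Ma Mb) M₁, max (max Na Nb) N₁, hρ, hB0,
    lt_max_of_lt_left (lt_max_of_lt_left hMa), lt_max_of_lt_left (lt_max_of_lt_left hNa), ?_⟩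
  intro Mh k R P D q hL hM hMh hP h3 hM0 hR hN0 hP4
  have hMa' : Ma ≤ ((ℓ : ℝ) + 1) * Mh := ((le_max_left _ _).trans (le_max_left _ _)).trans hM0
  have hMb' : Mb ≤ ((ℓ : ℝ) + 1) * Mh := ((le_max_right _ _).trans (le_max_left _ _)).trans hM0
  have hM1' : M₁ ≤ ((ℓ : ℝ) + 1) * Mh := (le_max_right _ _).trans hM0
  have hNa' : Na + 1 ≤ R * ((ℓ + 1) * Mh) :=
    le_trans (Nat.succ_le_succ ((le_max_left _ _).trans (le_max_left _ _))) hN0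
  have hNb' : Nb + 1 ≤ R * ((ℓ + 1) * Mh) :=
    le_trans (Nat.succ_le_succ ((le_max_right _ _).trans (le_max_left _ _))) hN0
  have hN1' : N₁ + 1 ≤ R * ((ℓ + 1) * Mh) := le_trans (Nat.succ_le_succ (le_max_right _ _)) hN0
  obtain ⟨h1, h2, -, hG⟩ := hP23 D q hL hM hMh hP hP4 hR hM1'
  have hTG0 := hA D q hL hM hMh hP h3 hMa' hR hNa' hP4
  have hTD0 := hB D q hL hM hMh hP h3 hMb' hR hNb' hP4
  have hdist := (triangle_refl_nonneg_T (cubeFam D q hL hM hMh hP) hMh hP).2.2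
  have hL0 : (0 : ℝ) ≤ (ℓ : ℝ) + 1 := by positivity
  -- merge the constants of the two Prop.-2.2 majorants: `C := max Ca Cb`, `δ₀ := min δa δb`
  have hmono : ∀ (Cx δx : ℝ) (n : ℕ), Cx ≤ max Ca Cb → min δa δb ≤ δx → 0 ≤ Cx →
      ∀ y y' : (geomT (cubeFam D q hL hM hMh hP)).Site,
        Cx * ((ℓ : ℝ) + 1) ^ n * Real.exp (-(δx / 2 * (geomT (cubeFam D q hL hM hMh hP)).dist y y')) ≤
          max Ca Cb * ((ℓ : ℝ) + 1) ^ n * Real.exp (-(min δa δb / 2 * (geomT (cubeFam D q hL hM hMh hP)).dist y y')) := by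
    intro Cx δx n hCx hδx hCx0 y y'
    have hd := hdist y y'
    refine mul_le_mul (mul_le_mul_of_nonneg_right hCx (pow_nonneg hL0 n)) (Real.exp_le_exp.2 ?_) (Real.exp_nonneg _)
      (mul_nonneg hC.le (pow_nonneg hL0 n))
    nlinarith
  have hTG : HasMajorant (g := geomT (cubeFam D q hL hM hMh hP)) (blkOf (cubeFam D q hL hM hMh hP).toDomains)
      (Matrix.toLin' (B6MultiLevelTorusOperator.gmlT (N0 ℓ Mh k P) ℓ k (cubeFam D q hL hM hMh hP).lev (wCube ℓ)))
      (fun y y' => max Ca Cb * ((ℓ : ℝ) + 1) ^ (2 * y.1.1) *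
        Real.exp (-(min δa δb / 2 * (geomT (cubeFam D q hL hM hMh hP)).dist y y'))) :=
    hasMajorant_mono _ hTG0 fun y y' => hmono Ca δa (2 * y.1.1) (le_max_left _ _) (min_le_left _ _) hCa.le y y'
  have hTD : ∀ μ : Fin (d + 1), HasMajorant (g := geomT (cubeFam D q hL hM hMh hP)) (blkOf (cubeFam D q hL hM hMh hP).toDomains)
      (Matrix.toLin' (dT (N0 ℓ Mh k P) μ *
        B6MultiLevelTorusOperator.gmlT (N0 ℓ Mh k P) ℓ k (cubeFam D q hL hM hMh hP).lev (wCube ℓ)))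
      (fun y y' => max Ca Cb * ((ℓ : ℝ) + 1) ^ y.1.1 *
        Real.exp (-(min δa δb / 2 * (geomT (cubeFam D q hL hM hMh hP)).dist y y'))) := fun μ =>
    hasMajorant_mono _ (hTD0 μ) fun y y' => hmono Cb δb y.1.1 (le_max_right _ _) (min_le_right _ _) hCb.le y y'
  exact ⟨h1, h2, fun f => pProjMLT_idem h2 f, fun f => pProjMLT_rProjMLT h2 f,
    hmain k Mh R hMh hN1' P hP (cubeFam D q hL hM hMh hP) (wCube ℓ) (fun μ => dT (N0 ℓ Mh k P) μ) hTG hTD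
      (CinvCubeW D q hL hM hMh hP) hG⟩

end Literature.MathematicalPhysics.QuantumFieldTheory.Balaban1983to89.B9Ineq349CubeLocalFlat
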